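import Mathlib
import HarnessLib
import Literature.MathematicalPhysics.QuantumLattice.GaugeGroupsProofs

/-!
# The trace of an `SU(3)` matrix lies in the closed deltoid: `|t|⁴ − 8 Re t³ + 18 |t|² − 27 = −∏_{i<j} |λᵢ − λⱼ|² ≤ 0`; a real trace forces `−1 ≤ tr U ≤ 3`

HONEST FRAMING: exact (Metropolis-corrected) sampling algorithms for lattice gauge theory;
figures of merit are autocorrelation/cost numbers at stated couplings and volumes; no
continuum-physics claim.

Venture `LatticeQCDFlow` (cell pub-lqcd), sub-topic `Scoring`; FANOUT row 21 (`su3-base`: the 4D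
`SU(3)` baselines).  NEW WORK of the cell (placement rule), elementary, over the Literature file
`QuantumLattice/GaugeGroupsProofs` (`exists_conj_eq_diagonal`: the torus theorem, Bröcker–tom Dieck
IV (3.1); unit-circle helpers); no definition is introduced; nothing is cited as a fact; no number of
ours.

For `U ∈ SU(3)` the characteristic polynomial is `X³ − t X² + t̄ X − 1`, `t = tr U` (its roots, the
eigenvalues `λ₁, λ₂, λ₃`, are unimodular with product `1`, so `e₂ = λ₁λ₂ + λ₁λ₃ + λ₂λ₃ = conj t`).
Its discriminant `∏_{i<j} (λᵢ − λⱼ)²` is, in terms of `t`,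
`e₁²e₂² − 4e₂³ − 4e₁³ + 18e₁e₂ − 27 = |t|⁴ − 8 Re(t³) + 18|t|² − 27`, and for unimodular roots
`(λᵢ − λⱼ)² = −λᵢλⱼ |λᵢ − λⱼ|²`, so the discriminant equals `−∏_{i<j} |λᵢ − λⱼ|² ≤ 0`.  The set
`{|t|⁴ − 8 Re t³ + 18|t|² − 27 ≤ 0}` is the closed region bounded by the three-cusped hypocycloid
(deltoid) through `3, 3e^{2πi/3}, 3e^{−2πi/3}`; its boundary consists of the elements with a repeated
eigenvalue, its cusps are the centre.  On the real axis the constraint reads `(t − 3)³ (t + 1) ≤ 0`,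
i.e. `−1 ≤ t ≤ 3`: an `SU(3)` matrix with REAL trace (equivalently, one conjugate to its inverse) has
`Re tr U ≥ −1`, not merely `≥ −3/2`.

## What is proved

* §1 (three unimodular numbers with product one, `t = a + b + c`) `conj_eq_mul_of_unimodular`
  (`conj a = b c`), **`su3Discriminant_eq_neg_prod_normSq`**:
  `t² t̄² − 4(t³ + t̄³) + 18 t t̄ − 27 = −(|a − b| |a − c| |b − c|)²` (as complex numbers),
  **`su3Discriminant_real_eq`**: `|t|⁴ − 8 Re(t³) + 18|t|² − 27 = −(|a − b| |a − c| |b − c|)²`.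
* §2 (`SU(3)`) **`su3_trace_discriminant_eq`** (for every diagonalisation `U = u diag(d) u⁻¹`),
  **`su3_trace_discriminant_nonpos`** (`≤ 0` for every `U ∈ SU(3)`),
  **`su3_trace_discriminant_eq_zero_iff`** (`= 0` iff the diagonalisation has a repeated entry),
  `su3_real_discriminant_factor` (`t⁴ − 8t³ + 18t² − 27 = (t − 3)³ (t + 1)`) and
  **`su3_neg_one_le_re_trace_of_im_eq_zero`**: `Im tr U = 0 ⟹ −1 ≤ Re tr U`.

NOT CLAIMED: that every point of the closed deltoid IS a trace (surjectivity onto the region), the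
induced (Weyl) density in the trace variable, or anything for `N ≠ 3`.
-/

namespace Summit.Ventures.LatticeQCDFlow.Scoring

open Matrix Complex
open Literature.MathematicalPhysics.QuantumLattice

/-! ## §1 Three unimodular numbers with product one -/

/-- On the unit circle with `a b c = 1`: `conj a = b c` (`conj a = a⁻¹ = b c`). -/
theorem conj_eq_mul_of_unimodular {a b c : ℂ} (ha : ‖a‖ = 1) (habc : a * b * c = 1) :
    (starRingEnd ℂ) a = b * c := by
  rw [← inv_eq_conj_of_norm_eq_one ha]
  have h : a * (b * c) = 1 := by rw [← mul_assoc]; exact habc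
  exact inv_eq_of_mul_eq_one_right h

/-- **The `SU(3)` discriminant identity** (complex form): for unimodular `a, b, c` with `a b c = 1` and
`t = a + b + c`,
`t² t̄² − 4 (t³ + t̄³) + 18 t t̄ − 27 = (a−b)²(a−c)²(b−c)² = −(|a − b| |a − c| |b − c|)²`. -/
theorem su3Discriminant_eq_neg_prod_normSq {a b c : ℂ} (ha : ‖a‖ = 1) (hb : ‖b‖ = 1) (hc : ‖c‖ = 1)
    (habc : a * b * c = 1) :
    (a + b + c) ^ 2 * ((starRingEnd ℂ) (a + b + c)) ^ 2
        - 4 * ((a + b + c) ^ 3 + ((starRingEnd ℂ) (a + b + c)) ^ 3)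
        + 18 * (a + b + c) * (starRingEnd ℂ) (a + b + c) - 27
      = -(((‖a - b‖ * ‖a - c‖ * ‖b - c‖) ^ 2 : ℝ) : ℂ) := by
  -- the conjugates of the three roots
  have hca : (starRingEnd ℂ) a = b * c := conj_eq_mul_of_unimodular ha habc
  have hcb : (starRingEnd ℂ) b = a * c :=
    conj_eq_mul_of_unimodular hb (by rw [← habc]; ring)
  have hcc : (starRingEnd ℂ) c = a * b :=
    conj_eq_mul_of_unimodular hc (by rw [← habc]; ring)
  have hct : (starRingEnd ℂ) (a + b + c) = a * b + a * c + b * c := by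
    rw [map_add, map_add, hca, hcb, hcc]; ring
  -- the discriminant as the product of squared root differences (uses `a b c = 1`)
  have hdisc : (a + b + c) ^ 2 * (a * b + a * c + b * c) ^ 2
        - 4 * ((a + b + c) ^ 3 + (a * b + a * c + b * c) ^ 3)
        + 18 * (a + b + c) * (a * b + a * c + b * c) - 27
      = (a - b) ^ 2 * (a - c) ^ 2 * (b - c) ^ 2 := by
    linear_combination
      (4 * (a + b + c) ^ 3 - 18 * (a + b + c) * (a * b + a * c + b * c) + 27 * (a * b * c + 1)) * habc
  -- squared differences of unimodular numbers: `(x − y)² = −x y |x − y|²`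
  have hsq : ∀ x y : ℂ, x * (starRingEnd ℂ) x = 1 → y * (starRingEnd ℂ) y = 1 →
      (starRingEnd ℂ) x - (starRingEnd ℂ) y = -((starRingEnd ℂ) x * (starRingEnd ℂ) y * (x - y)) →
      (x - y) ^ 2 = -(x * y) * (((‖x - y‖ ^ 2 : ℝ) : ℂ)) := by
    intro x y hx hy hxy
    have hn : (((‖x - y‖ ^ 2 : ℝ) : ℂ)) = (x - y) * ((starRingEnd ℂ) x - (starRingEnd ℂ) y) := by
      rw [← map_sub, Complex.mul_conj, Complex.normSq_eq_norm_sq]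
    rw [hn]
    linear_combination (x * y * (x - y)) * hxy + (-(x - y) ^ 2 * y * (starRingEnd ℂ) y) * hx
      + (-(x - y) ^ 2) * hy
  have ha1 : a * (starRingEnd ℂ) a = 1 := mul_conj_of_norm_eq_one ha
  have hb1 : b * (starRingEnd ℂ) b = 1 := mul_conj_of_norm_eq_one hb
  have hc1 : c * (starRingEnd ℂ) c = 1 := mul_conj_of_norm_eq_one hc
  have hab : (a - b) ^ 2 = -(a * b) * (((‖a - b‖ ^ 2 : ℝ) : ℂ)) :=
    hsq a b ha1 hb1 (by rw [hca, hcb]; linear_combination (c * (a - b)) * habc)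
  have hac : (a - c) ^ 2 = -(a * c) * (((‖a - c‖ ^ 2 : ℝ) : ℂ)) :=
    hsq a c ha1 hc1 (by rw [hca, hcc]; linear_combination (b * (a - c)) * habc)
  have hbc : (b - c) ^ 2 = -(b * c) * (((‖b - c‖ ^ 2 : ℝ) : ℂ)) :=
    hsq b c hb1 hc1 (by rw [hcb, hcc]; linear_combination (a * (b - c)) * habc)
  rw [hct, hdisc, hab, hac, hbc]
  push_cast
  linear_combination
    (-(((‖a - b‖ : ℝ) : ℂ)) ^ 2 * (((‖a - c‖ : ℝ) : ℂ)) ^ 2 * (((‖b - c‖ : ℝ) : ℂ)) ^ 2 *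
      (a * b * c + 1)) * habc

/-- **The `SU(3)` discriminant identity** (real form): for unimodular `a, b, c` with `a b c = 1` and
`t = a + b + c`, `|t|⁴ − 8 Re(t³) + 18 |t|² − 27 = −(|a − b| |a − c| |b − c|)²`. -/
theorem su3Discriminant_real_eq {a b c : ℂ} (ha : ‖a‖ = 1) (hb : ‖b‖ = 1) (hc : ‖c‖ = 1)
    (habc : a * b * c = 1) :
    ‖a + b + c‖ ^ 4 - 8 * ((a + b + c) ^ 3).re + 18 * ‖a + b + c‖ ^ 2 - 27
      = -((‖a - b‖ * ‖a - c‖ * ‖b - c‖) ^ 2) := by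
  have h := su3Discriminant_eq_neg_prod_normSq ha hb hc habc
  set t : ℂ := a + b + c with ht
  have h1 : t ^ 2 * ((starRingEnd ℂ) t) ^ 2 = (((‖t‖ ^ 4 : ℝ)) : ℂ) := by
    rw [← mul_pow, Complex.mul_conj, Complex.normSq_eq_norm_sq]; push_cast; ring_nf
  have h2 : t ^ 3 + ((starRingEnd ℂ) t) ^ 3 = (((2 * (t ^ 3).re : ℝ)) : ℂ) := by
    rw [← map_pow, Complex.add_conj]
  have h3 : 18 * t * (starRingEnd ℂ) t = (((18 * ‖t‖ ^ 2 : ℝ)) : ℂ) := by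
    rw [mul_assoc, Complex.mul_conj, Complex.normSq_eq_norm_sq]; push_cast; ring
  rw [h1, h2, h3] at h
  apply Complex.ofReal_injective
  push_cast at h ⊢
  linear_combination h

/-! ## §2 `SU(3)`: the trace lies in the closed deltoid -/

section SpecialUnitaryThree

/-- The trace of `u D u⁻¹` is the trace of `D`: for a diagonalisation `U = u diag(d) u⁻¹` in `SU(3)`,
`tr U = d₀ + d₁ + d₂`. -/
theorem su3_trace_eq_sum_of_conj_diagonal {U u D : Matrix.specialUnitaryGroup (Fin 3) ℂ}
    {d : Fin 3 → ℂ} (hD : (D : Matrix (Fin 3) (Fin 3) ℂ) = diagonal d) (hU : U = u * D * u⁻¹) :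
    (U : Matrix (Fin 3) (Fin 3) ℂ).trace = d 0 + d 1 + d 2 := by
  rw [hU]
  change ((u : Matrix (Fin 3) (Fin 3) ℂ) * (D : Matrix (Fin 3) (Fin 3) ℂ) *
      star (u : Matrix (Fin 3) (Fin 3) ℂ)).trace = _
  rw [Matrix.trace_mul_cycle, Unitary.star_mul_self_of_mem u.2.1, Matrix.one_mul, hD, trace_diagonal,
    Fin.sum_univ_three]

/-- **The discriminant of an `SU(3)` matrix in terms of its trace**: for every diagonalisation
`U = u diag(d) u⁻¹`, with `t = tr U`,
`|t|⁴ − 8 Re(t³) + 18|t|² − 27 = −(|d₀ − d₁| |d₀ − d₂| |d₁ − d₂|)²`. -/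
theorem su3_trace_discriminant_eq {U u D : Matrix.specialUnitaryGroup (Fin 3) ℂ} {d : Fin 3 → ℂ}
    (hD : (D : Matrix (Fin 3) (Fin 3) ℂ) = diagonal d) (hU : U = u * D * u⁻¹) :
    ‖(U : Matrix (Fin 3) (Fin 3) ℂ).trace‖ ^ 4 - 8 * (((U : Matrix (Fin 3) (Fin 3) ℂ).trace) ^ 3).re
        + 18 * ‖(U : Matrix (Fin 3) (Fin 3) ℂ).trace‖ ^ 2 - 27
      = -((‖d 0 - d 1‖ * ‖d 0 - d 2‖ * ‖d 1 - d 2‖) ^ 2) := by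
  have h1 := norm_eq_one_of_coe_eq_diagonal hD
  have hp := prod_eq_one_of_coe_eq_diagonal hD
  rw [Fin.prod_univ_three] at hp
  rw [su3_trace_eq_sum_of_conj_diagonal hD hU]
  exact su3Discriminant_real_eq (h1 0) (h1 1) (h1 2) hp

/-- **The trace of every `SU(3)` matrix lies in the closed deltoid**:
`|t|⁴ − 8 Re(t³) + 18|t|² − 27 ≤ 0` for `t = tr U`, `U ∈ SU(3)`. -/
theorem su3_trace_discriminant_nonpos (U : Matrix.specialUnitaryGroup (Fin 3) ℂ) :
    ‖(U : Matrix (Fin 3) (Fin 3) ℂ).trace‖ ^ 4 - 8 * (((U : Matrix (Fin 3) (Fin 3) ℂ).trace) ^ 3).re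
        + 18 * ‖(U : Matrix (Fin 3) (Fin 3) ℂ).trace‖ ^ 2 - 27 ≤ 0 := by
  obtain ⟨u, D, d, hD, hU⟩ := exists_conj_eq_diagonal U
  rw [su3_trace_discriminant_eq hD hU, neg_nonpos]
  positivity

/-- **The boundary of the deltoid is the set of degenerate spectra**: for a diagonalisation
`U = u diag(d) u⁻¹`, the discriminant expression vanishes iff two of the `dᵢ` coincide. -/
theorem su3_trace_discriminant_eq_zero_iff {U u D : Matrix.specialUnitaryGroup (Fin 3) ℂ}
    {d : Fin 3 → ℂ} (hD : (D : Matrix (Fin 3) (Fin 3) ℂ) = diagonal d) (hU : U = u * D * u⁻¹) :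
    ‖(U : Matrix (Fin 3) (Fin 3) ℂ).trace‖ ^ 4 - 8 * (((U : Matrix (Fin 3) (Fin 3) ℂ).trace) ^ 3).re
        + 18 * ‖(U : Matrix (Fin 3) (Fin 3) ℂ).trace‖ ^ 2 - 27 = 0 ↔
      (d 0 = d 1 ∨ d 0 = d 2 ∨ d 1 = d 2) := by
  rw [su3_trace_discriminant_eq hD hU, neg_eq_zero, sq_eq_zero_iff, mul_eq_zero, mul_eq_zero,
    norm_eq_zero, norm_eq_zero, norm_eq_zero, sub_eq_zero, sub_eq_zero, sub_eq_zero, or_assoc]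

/-- On the real axis the deltoid polynomial factors: `t⁴ − 8t³ + 18t² − 27 = (t − 3)³ (t + 1)`. -/
theorem su3_real_discriminant_factor (t : ℝ) :
    t ^ 4 - 8 * t ^ 3 + 18 * t ^ 2 - 27 = (t - 3) ^ 3 * (t + 1) := by
  ring

/-- **An `SU(3)` matrix with real trace has `−1 ≤ Re tr U`** (sharper than the general `−3/2`):
for real `t` the deltoid constraint is `(t − 3)³(t + 1) ≤ 0`, and `t ≤ 3`. -/
theorem su3_neg_one_le_re_trace_of_im_eq_zero (U : Matrix.specialUnitaryGroup (Fin 3) ℂ)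
    (him : ((U : Matrix (Fin 3) (Fin 3) ℂ).trace).im = 0) :
    -1 ≤ ((U : Matrix (Fin 3) (Fin 3) ℂ).trace).re := by
  set t : ℂ := (U : Matrix (Fin 3) (Fin 3) ℂ).trace with ht
  have hreal : t = ((t.re : ℝ) : ℂ) := by
    apply Complex.ext <;> simp [him]
  have hdisc := su3_trace_discriminant_nonpos U
  rw [← ht] at hdisc
  have hn : ‖t‖ = |t.re| := by
    rw [hreal, Complex.norm_real, Real.norm_eq_abs, Complex.ofReal_re]
  have h3 : (t ^ 3).re = t.re ^ 3 := by
    rw [hreal, ← Complex.ofReal_pow, Complex.ofReal_re, Complex.ofReal_re]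
  rw [hn, h3] at hdisc
  have h4 : |t.re| ^ 4 = t.re ^ 4 := by
    rw [show (4 : ℕ) = 2 * 2 from rfl, pow_mul, sq_abs, ← pow_mul]
  rw [h4, sq_abs, su3_real_discriminant_factor] at hdisc
  -- `t.re ≤ 3` (all eigenvalues on the unit circle)
  have hle : t.re ≤ 3 := by
    have h := reTr_le U
    simp only [Fintype.card_fin, Nat.cast_ofNat] at h
    exact h
  by_contra hlt
  rw [not_le] at hlt
  have h1 : (t.re - 3) ^ 3 < 0 := by
    have : t.re - 3 < 0 := by linarith
    exact Odd.pow_neg (by decide) this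
  have h2 : t.re + 1 < 0 := by linarith
  nlinarith [mul_pos_of_neg_of_neg h1 h2]

end SpecialUnitaryThree

end Summit.Ventures.LatticeQCDFlow.Scoring
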